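import Summits.CriticalPhenomena.PercolationContinuityZ3.Theorems.Transplant.PlanarSkeletonFrmQuasiDefs
import Summits.CriticalPhenomena.PercolationContinuityZ3.Theorems.Transplant.SkelFrmQuasiBChoiceAtQ
import Summits.CriticalPhenomena.PercolationContinuityZ3.Theorems.Transplant.SkelFrmBChoiceAtQ
import Summits.CriticalPhenomena.PercolationContinuityZ3.Theorems.Transplant.SkelFrmQuasiBParamsSlotsRS
import Summits.CriticalPhenomena.PercolationContinuityZ3.Theorems.Transplant.SkelFrmBParamsSlotsRS
import Summits.CriticalPhenomena.PercolationContinuityZ3.Theorems.Transplant.SkelNegBParamsRootK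
import Summits.CriticalPhenomena.PercolationContinuityZ3.Theorems.Transplant.SkelFrmQuasi1ChoiceDefs
import Summits.CriticalPhenomena.PercolationContinuityZ3.Theorems.Transplant.SkelFrmQuasi1ParamsPO
import Summits.CriticalPhenomena.PercolationContinuityZ3.Theorems.Transplant.SkelFrmQuasiBChoiceDefs3
import Summits.CriticalPhenomena.PercolationContinuityZ3.Theorems.Transplant.SkelFrmQuasiBParamsLF
import HarnessLib
import Summits.CriticalPhenomena.PercolationContinuityZ3.Theorems.Transplant.SkelFrmBChoiceKit
/-!
# GEN-Q PORT (WAVE-Q table v0.8 section 2, row G056, U-level L10; captain R-6/R-7 2026-08-27: carrier token swap `PlanarSkeletonFrmFrom ↦ PlanarSkeletonFrmQuasi`)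
# of the tree module «Transplant/SkelFrmFromBChoiceKit» (sha256 cf655a1debbef68a…) onto the quasi-step carrier `PlanarSkeletonFrmQuasi` (p507026): «SkelFrmQuasiBChoiceKit»

ORIGINAL TITLE: N2 (frames-only node `SamePDropOfSkeletonFrm₁`, OPEN), WAVE 1: THE KIT PAIR AND THE ZONE AT `AtQNQ` OF THE CHOICES OF RECORD — `clauseK_of_atQ`, `κK_int_of_atQ`,

builds on p205010 (kernel theorem, internal audit signed; external expert review pending) — nothing in this file uses p205010; NOTHING is claimed about any open node
((N3-b), the end state).  Lane `prim-bschramm`, seat `prim-hp-8` (gen 62; GEN-Q pen, family BChoiceRoot*/1Root*/BParamsKit·Bridge; tool = captain gen-1 g4's port_genq.py R-14 + p3-g30 T1/T2 + stmt-g33 --force-keep).  Helper file (`--supports stmt-CriticalPhenomena-4575 --as helper`).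
PORT RULES (U-wave r1–r4 re-used, GEN-Q hunk classes of p3-g29 #6136): declaration order, names and proof texts are those of «SkelFrmFromBChoiceKit», byte-identical except
(i) the carrier token `PlanarSkeletonFrmFrom ↦ PlanarSkeletonFrmQuasi` in binders, `namespace`/`end` lines and qualified names (module names `SkelFrmFrom… ↦ SkelFrmQuasi…`
in imports of already-ported rows); (ii) `Φ.step ↦ Φ.qstep` with the called Steps lemma replaced by its `…Q`/`_q` twin and the cost `Φ.M` threaded (none in this file unless
listed below); (iii) `Φ.cyl_connected ↦ Φ.cyl_reach` readers (none unless listed); (iv) graph-ball radii / window floors ×`Φ.M` (none unless listed).  Carrier-free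
residents stay imported/exported from the original «SkelFrmBChoiceKit» exactly as in the FrmFrom port.  Docstrings and citations are the original's.

-/

noncomputable section

open scoped Classical

namespace Summit.CriticalPhenomena.PercolationContinuityZ3.Theorems.Transplant

open MeasureTheory Literature.Probability.Percolation Literature.Probability.LatticeModels SimpleGraph KNCells

namespace PlanarSkeletonFrmQuasi

open SkelConc (Consts)
open Skelφ (oriφ trφ)
open Skelφ.StepI (DataN DataNS OutNS)

namespace NegB

open Neg

section AtQ

variable {κ : Consts} {V : Type} [DecidableEq V] [Countable V] {G : SimpleGraph V} [G.LocallyFinite] {Φ : PlanarSkeletonFrmQuasi G} {t : V} {p : unitInterval}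
  {hC : Φ.CylSubcritical p} {gv fv : Neg.FSlot} {Pv : PSlot} {Sv : SSlot} {cv : CSlot} {bv : BSlot} {O : OutNS V} {q : unitInterval} (mk : ℕ)

/-- **The kit pair's clause (map `φK`, `|h_kit| ≤ 10 n_kit`)** out of `AtQNQ`, any kit index `mk`. [this work] -/
theorem clauseK_of_atQ {κ : Consts} {V : Type} [DecidableEq V] [Countable V] {G : SimpleGraph V} [G.LocallyFinite] {Φ : PlanarSkeletonFrmQuasi G} {t : V} {p : unitInterval} {hC : Φ.CylSubcritical p} {gv : Neg.FSlot} {fv : Neg.FSlot} {Pv : PSlot} {Sv : SSlot} {cv : CSlot} {bv : BSlot} {O : OutNS V} {q : unitInterval} (mk : ℕ) (hAt : (choiceAtQ3 κ Φ t p Pv gv fv Sv cv bv hC).AtQNQ O q) :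
    O.merged.EqGeom G (KS.φK Φ t O.D O.DT.toDataN O.ori mk) t (KS.MK O.merged mk) (KS.nKit O.merged mk) ∧
      (KS.hKit t O.merged mk).natAbs ≤ 10 * KS.nKit O.merged mk :=
  KS.clauseK_of_factsO Φ t O.D O.DT.toDataN O.ori mk (shared_of_atQ hAt).2.2.1 (clauses_of_atQ hAt)

-- GEN-Q (R-2, captain 2026-08-27): `PlanarSkeletonFrmFrom.NegB.κK_int_of_atQ` is not in the used cone of the node top — not ported.

-- GEN-Q (R-2, captain 2026-08-27): `PlanarSkeletonFrmFrom.NegB.ℓKit_ge_of_atQ` is not in the used cone of the node top — not ported.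

/-- **`hΛRg`**: at `AtQNQ`, for every kit index `mk` and every centre `c`, the zone `Λ c M_u` of the merged record lies in the kit pair's prism `KS.RgK … mk φK c`.
[cite: KozmaNitzan2024, §4 p. 28 ((32): the zone inside the kit region)] -/
theorem hΛRg_of_atQ {κ : Consts} {V : Type} [DecidableEq V] [Countable V] {G : SimpleGraph V} [G.LocallyFinite] {Φ : PlanarSkeletonFrmQuasi G} {t : V} {p : unitInterval} {hC : Φ.CylSubcritical p} {gv : Neg.FSlot} {fv : Neg.FSlot} {Pv : PSlot} {Sv : SSlot} {cv : CSlot} {bv : BSlot} {O : OutNS V} {q : unitInterval} (mk : ℕ) (hAt : (choiceAtQ3 κ Φ t p Pv gv fv Sv cv bv hC).AtQNQ O q) :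
    ∀ c, O.merged.Λ c (Mu O.merged) ⊆ KS.RgK G t O.merged mk (KS.φK Φ t O.D O.DT.toDataN O.ori mk) c := by
  intro c
  obtain ⟨-, -, -, hReq, hΛeq⟩ := Skelφ.StepI.OutO.FactsO.seed hAt.1.factsO
  obtain ⟨hE, hh⟩ := clauseK_of_atQ mk hAt
  have hℓ := KS.ℓKit_ge t O.merged mk _ hE
  have hMu : Mu O.merged ≤ KS.nKit O.merged mk := by have := (KS.nKit_facts O.merged mk).2.2.2.1; omega
  have hscale : Mu O.merged ≤ O.merged.scale t (KS.MK O.merged mk) (KS.nKit O.merged mk) := le_trans hMu (le_max_left _ _)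
  have hReq' : ∀ n, O.merged.R n = Skelφ.fatRadius Φ.frame hC n := fun n => congrFun hReq n
  have hΛeq' : O.merged.Λ c (Mu O.merged) = Skelφ.fatSeq Φ.frame hC c (Mu O.merged) := by
    have := congrFun (congrFun hΛeq c) (Mu O.merged); exact this
  have hR : Skelφ.fatRadius Φ.frame hC (Mu O.merged) ≤ KS.RK t O.merged mk := by
    unfold KS.RK; rw [hReq']; exact Skelφ.fatRadius_mono Φ.frame hC hscale
  rw [hΛeq']
  exact Skelφ.fatSeq_subset_pgramPrismFin Φ.frame hC _ hMu hh (by omega) hR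

/-! ## The inputs at the consumers' CUBE thresholds ((R-33): `δI3 ≤ a³` whenever `δkit ≤ a`, `a ∈ {κ.δ, κ.δ₂, κ.δr n}`) -/

-- GEN-Q (R-2, captain 2026-08-27): `PlanarSkeletonFrmFrom.NegB.inputsLAt_cube_of_atQ` is not in the used cone of the node top — not ported.

-- GEN-Q (R-2, captain 2026-08-27): `PlanarSkeletonFrmFrom.NegB.inputsSAt_cube_of_atQ` is not in the used cone of the node top — not ported.

-- GEN-Q (R-2, captain 2026-08-27): `PlanarSkeletonFrmFrom.NegB.inputsPAt_cube_of_atQ` is not in the used cone of the node top — not ported.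

-- GEN-Q (R-2, captain 2026-08-27): `PlanarSkeletonFrmFrom.NegB.zoneAt_cube_of_atQ` is not in the used cone of the node top — not ported.

end AtQ

end NegB

end PlanarSkeletonFrmQuasi

end Summit.CriticalPhenomena.PercolationContinuityZ3.Theorems.Transplant

end
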